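import Mathlib
import Summits.Ventures.PercRepro2.RootEdgeCells

/-!
# The root edge, II: the remaining cell sums, the four transfers, and the half identity
(blind cell PercRepro2, night-3 g21, 2026-08-28; `proofs/NIGHT3-CERT.md` §30)

With `P^s = p[g := s]` at the root edge `g = {a₁, v}` and
`Ψ_st = P^s(Q, bL) P^t(Q, oH) − P^s(Q, oH, bL) P^t(Q)` (the `(b ∈ C₁, o ∈ C₂)`-half of the BHK slack
between two laws), **`half_identity`**: `Ψ₀₁ + Ψ₁₀ − Ψ₁₁ = Ψ′ + (3M)-term + (F)-term`, where `Ψ′`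
is the same half-slack of `P⁰` on `Q′ = Q ∩ {v ∉ C₂}` and the two terms are the cell expressions of
`RootEdgeCells.lean` (`ThreeMark`, `BVCross`).  Applied to `(b, o)` and to `(o, b)` this is the
exact decomposition `M − Φ₁₁ = Φ′ + cross_h(v,o;b) + cross_h(v,b;o) + cross_F(v,o;b) + cross_F(v,b;o)`
of g20's root-edge row slack (own exact control: 334,053 / 334,053 instances, kit j308130).

**CORRECTION of `RootEdgeCells.lean` (same seat, the same afternoon):** the candidate `BVCross` (F)
there is FALSE — kit j308130 (12 cores, 1,233,694 random instances, p ∈ {k/4, k/3, k/8, k/16, 1})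
found 227 exact failures with distinct marks at n = 5…8 (e.g. n = 5, edges (3,0)⅓ (2,0)15/16
(0,4)⅔ (1,0)⅔ (4,1)15/16 (3,4)1/16 (2,4)⅓ (2,1)⅞, (a₁,a₂,b,o,v) = (1,0,2,4,3), slack
−34891/3522410053632); `ThreeMark` (3M) stands (0 / 427,670 nonzero rows there).  The candidate that
the census supports is the PER-PAIR sum **`RootCross` := (3M)-term + (F)-term** below — the mixed
BHK 1.4 cross term between the world `{v ∈ C₂}` of `G − g` and the contraction `G / g` for the pair
`(b ∈ C₁, o ∈ C₂)`; in the cells `m⁺(0, ω, β⁺)` of `G − g` with `b`'s side measured against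
`C₁ ∪ C(v)`: `m(101)m⁺(010) + m⁺(001)m(110) ≥ m⁺(011)m(100) + m(111)m⁺(000)`
(0 failures on every per-pair row of j308130's (F)-failures and of the local census; kit j308669).
Own work; standard axioms.
-/

namespace Summit.Ventures.PercRepro2

open UnionCluster

namespace CovForm

namespace RootEdge

open A3Inactive

variable {V : Type*} {E : Type*} [Fintype E] [DecidableEq E] [DecidableEq V]
  {R : Type*} [Field R] [LinearOrder R] [IsStrictOrderedRing R]

omit [DecidableEq V] [LinearOrder R] [IsStrictOrderedRing R] in
/-- `P(Q′) = P(Q, v ∉ C₂)` = the four cells with `χ = false`. -/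
lemma mass_Q' (p : E → R) (ends : E → Sym2 V) (a₁ a₂ b o v : V) :
    prob p ({ω' | ω' ∈ avoidAll ends a₂ {a₁} ∧ ¬ Conn ends ω' a₂ v}) =
      cell p ends a₁ a₂ b o v false true true + cell p ends a₁ a₂ b o v false true false + cell p ends a₁ a₂ b o v false false true + cell p ends a₁ a₂ b o v false false false := by
  rw [prob_eq_sum_cells p ends a₁ a₂ b o v]
  have e : ∀ χ ω β : Bool, ({ω' | ω' ∈ avoidAll ends a₂ {a₁} ∧ ¬ Conn ends ω' a₂ v}) ∩ cellSet ends a₁ a₂ b o v χ ω β =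
      if χ = false then avoidAll ends a₂ {a₁} ∩ cellSet ends a₁ a₂ b o v χ ω β else ∅ := by
    intro χ ω β
    cases χ <;> cases ω <;> cases β <;>
      · ext ω'
        simp only [Set.mem_inter_iff, Set.mem_empty_iff_false, cellSet, Set.mem_setOf_eq,
          Bool.false_eq_true, Bool.true_eq_false, iff_false, iff_true, if_true,
          if_false]
        tauto
  simp only [e, Bool.true_eq_false,
    if_true, if_false, prob_empty, cell]
  ring

omit [DecidableEq V] [LinearOrder R] [IsStrictOrderedRing R] in
/-- `P(Q′, o ∈ C₂)` = the two cells with `χ = false`, `ω = true`. -/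
lemma mass_Q'oH (p : E → R) (ends : E → Sym2 V) (a₁ a₂ b o v : V) :
    prob p ({ω' | ω' ∈ avoidAll ends a₂ {a₁} ∧ ¬ Conn ends ω' a₂ v ∧ Conn ends ω' a₂ o}) =
      cell p ends a₁ a₂ b o v false true true + cell p ends a₁ a₂ b o v false true false := by
  rw [prob_eq_sum_cells p ends a₁ a₂ b o v]
  have e : ∀ χ ω β : Bool, ({ω' | ω' ∈ avoidAll ends a₂ {a₁} ∧ ¬ Conn ends ω' a₂ v ∧ Conn ends ω' a₂ o}) ∩ cellSet ends a₁ a₂ b o v χ ω β =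
      if χ = false ∧ ω = true then avoidAll ends a₂ {a₁} ∩ cellSet ends a₁ a₂ b o v χ ω β else ∅ := by
    intro χ ω β
    cases χ <;> cases ω <;> cases β <;>
      · ext ω'
        simp only [Set.mem_inter_iff, Set.mem_empty_iff_false, cellSet, Set.mem_setOf_eq,
          Bool.false_eq_true, Bool.true_eq_false, iff_false, iff_true, if_true,
          if_false, and_self, and_true, and_false]
        tauto
  simp only [e, Bool.false_eq_true, Bool.true_eq_false, and_self,
    and_true, and_false, if_true, if_false, prob_empty, cell]
  ring

omit [DecidableEq V] [LinearOrder R] [IsStrictOrderedRing R] in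
/-- `P(Q′, b ∈ C₁)` = the two cells with `χ = false`, `β = true`. -/
lemma mass_Q'bL (p : E → R) (ends : E → Sym2 V) (a₁ a₂ b o v : V) :
    prob p ({ω' | ω' ∈ avoidAll ends a₂ {a₁} ∧ ¬ Conn ends ω' a₂ v ∧ Conn ends ω' a₁ b}) =
      cell p ends a₁ a₂ b o v false true true + cell p ends a₁ a₂ b o v false false true := by
  rw [prob_eq_sum_cells p ends a₁ a₂ b o v]
  have e : ∀ χ ω β : Bool, ({ω' | ω' ∈ avoidAll ends a₂ {a₁} ∧ ¬ Conn ends ω' a₂ v ∧ Conn ends ω' a₁ b}) ∩ cellSet ends a₁ a₂ b o v χ ω β =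
      if χ = false ∧ β = true then avoidAll ends a₂ {a₁} ∩ cellSet ends a₁ a₂ b o v χ ω β else ∅ := by
    intro χ ω β
    cases χ <;> cases ω <;> cases β <;>
      · ext ω'
        simp only [Set.mem_inter_iff, Set.mem_empty_iff_false, cellSet, Set.mem_setOf_eq,
          Bool.false_eq_true, Bool.true_eq_false, iff_false, iff_true, if_true,
          if_false, and_self, and_true, and_false]
        tauto
  simp only [e, Bool.false_eq_true, Bool.true_eq_false, and_self,
    and_true, and_false, if_true, if_false, prob_empty, cell]
  ring

omit [DecidableEq V] [LinearOrder R] [IsStrictOrderedRing R] in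
/-- `P(Q′, o ∈ C₂, b ∈ C₁)` = the cell `χ = false`, `ω = β = true`. -/
lemma mass_Q'oHbL (p : E → R) (ends : E → Sym2 V) (a₁ a₂ b o v : V) :
    prob p ({ω' | ω' ∈ avoidAll ends a₂ {a₁} ∧ ¬ Conn ends ω' a₂ v ∧ Conn ends ω' a₂ o ∧ Conn ends ω' a₁ b}) =
      cell p ends a₁ a₂ b o v false true true := by
  rw [prob_eq_sum_cells p ends a₁ a₂ b o v]
  have e : ∀ χ ω β : Bool, ({ω' | ω' ∈ avoidAll ends a₂ {a₁} ∧ ¬ Conn ends ω' a₂ v ∧ Conn ends ω' a₂ o ∧ Conn ends ω' a₁ b}) ∩ cellSet ends a₁ a₂ b o v χ ω β =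
      if χ = false ∧ ω = true ∧ β = true then avoidAll ends a₂ {a₁} ∩ cellSet ends a₁ a₂ b o v χ ω β else ∅ := by
    intro χ ω β
    cases χ <;> cases ω <;> cases β <;>
      · ext ω'
        simp only [Set.mem_inter_iff, Set.mem_empty_iff_false, cellSet, Set.mem_setOf_eq,
          Bool.false_eq_true, Bool.true_eq_false, iff_false, iff_true, if_true,
          if_false, and_self, and_true, and_false]
        tauto
  simp only [e, Bool.false_eq_true, Bool.true_eq_false, and_self,
    and_true, and_false, if_true, if_false, prob_empty, cell]
  ring

omit [DecidableEq V] [LinearOrder R] [IsStrictOrderedRing R] in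
/-- `P(Q′, b ∈ C₁ ∪ C(v))` = the two `χ = false, β = true` cells + the two `b ~ v` cells. -/
lemma mass_Q'bLv (p : E → R) (ends : E → Sym2 V) (a₁ a₂ b o v : V) :
    prob p {ω' | ω' ∈ avoidAll ends a₂ {a₁} ∧ ¬ Conn ends ω' a₂ v ∧
        (Conn ends ω' a₁ b ∨ Conn ends ω' v b)} =
      cell p ends a₁ a₂ b o v false true true + cell p ends a₁ a₂ b o v false false true +
        bvcell p ends a₁ a₂ b o v true + bvcell p ends a₁ a₂ b o v false := by
  set Y : Set (Config E) := {ω' | ω' ∈ avoidAll ends a₂ {a₁} ∧ ¬ Conn ends ω' a₂ v ∧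
    (Conn ends ω' a₁ b ∨ Conn ends ω' v b)} with hY
  have h1 : Y ∩ connEvent ends a₁ b =
      {ω' | ω' ∈ avoidAll ends a₂ {a₁} ∧ ¬ Conn ends ω' a₂ v ∧ Conn ends ω' a₁ b} := by
    ext ω'
    simp only [hY, Set.mem_inter_iff, Set.mem_setOf_eq, mem_connEvent]
    tauto
  set Z : Set (Config E) := {ω' | ω' ∈ avoidAll ends a₂ {a₁} ∧ ¬ Conn ends ω' a₂ v ∧
    ¬ Conn ends ω' a₁ b ∧ Conn ends ω' v b} with hZ
  have h2 : Y ∩ (connEvent ends a₁ b)ᶜ = Z := by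
    ext ω'
    simp only [hY, hZ, Set.mem_inter_iff, Set.mem_setOf_eq, Set.mem_compl_iff, mem_connEvent]
    tauto
  have h3 : Z ∩ connEvent ends a₂ o = avoidAll ends a₂ {a₁} ∩ {ω' | ¬ Conn ends ω' a₂ v ∧
      ¬ Conn ends ω' a₁ b ∧ Conn ends ω' v b ∧ (Conn ends ω' a₂ o ↔ true = true)} := by
    ext ω'
    simp only [hZ, Set.mem_inter_iff, Set.mem_setOf_eq, mem_connEvent, iff_true]
    tauto
  have h4 : Z ∩ (connEvent ends a₂ o)ᶜ = avoidAll ends a₂ {a₁} ∩ {ω' | ¬ Conn ends ω' a₂ v ∧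
      ¬ Conn ends ω' a₁ b ∧ Conn ends ω' v b ∧ (Conn ends ω' a₂ o ↔ false = true)} := by
    ext ω'
    simp only [hZ, Set.mem_inter_iff, Set.mem_setOf_eq, Set.mem_compl_iff, mem_connEvent,
      Bool.false_eq_true, iff_false]
    tauto
  have s1 := prob_inter_add_prob_inter_compl p Y (connEvent ends a₁ b)
  have s2 := prob_inter_add_prob_inter_compl p Z (connEvent ends a₂ o)
  rw [h1, h2, mass_Q'bL] at s1
  rw [h3, h4] at s2
  unfold bvcell
  linear_combination -s1 - s2

omit [DecidableEq V] [LinearOrder R] [IsStrictOrderedRing R] in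
/-- `P(Q′, o ∈ C₂, b ∈ C₁ ∪ C(v))` = the cell `χ = false, ω = β = true` + the `b ~ v, o ∈ C₂` cell. -/
lemma mass_Q'oHbLv (p : E → R) (ends : E → Sym2 V) (a₁ a₂ b o v : V) :
    prob p {ω' | ω' ∈ avoidAll ends a₂ {a₁} ∧ ¬ Conn ends ω' a₂ v ∧ Conn ends ω' a₂ o ∧
        (Conn ends ω' a₁ b ∨ Conn ends ω' v b)} =
      cell p ends a₁ a₂ b o v false true true + bvcell p ends a₁ a₂ b o v true := by
  set Y : Set (Config E) := {ω' | ω' ∈ avoidAll ends a₂ {a₁} ∧ ¬ Conn ends ω' a₂ v ∧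
    Conn ends ω' a₂ o ∧ (Conn ends ω' a₁ b ∨ Conn ends ω' v b)} with hY
  have h1 : Y ∩ connEvent ends a₁ b = {ω' | ω' ∈ avoidAll ends a₂ {a₁} ∧ ¬ Conn ends ω' a₂ v ∧
      Conn ends ω' a₂ o ∧ Conn ends ω' a₁ b} := by
    ext ω'
    simp only [hY, Set.mem_inter_iff, Set.mem_setOf_eq, mem_connEvent]
    tauto
  have h2 : Y ∩ (connEvent ends a₁ b)ᶜ = avoidAll ends a₂ {a₁} ∩ {ω' | ¬ Conn ends ω' a₂ v ∧
      ¬ Conn ends ω' a₁ b ∧ Conn ends ω' v b ∧ (Conn ends ω' a₂ o ↔ true = true)} := by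
    ext ω'
    simp only [hY, Set.mem_inter_iff, Set.mem_setOf_eq, Set.mem_compl_iff, mem_connEvent, iff_true]
    tauto
  have s1 := prob_inter_add_prob_inter_compl p Y (connEvent ends a₁ b)
  rw [h1, h2, mass_Q'oHbL] at s1
  unfold bvcell
  linear_combination -s1

/-! ## The transfers of the four `P¹`-masses of the `(b ∈ C₁, o ∈ C₂)` half -/

omit [DecidableEq V] [LinearOrder R] [IsStrictOrderedRing R] in
/-- `P¹(Q) = P⁰(Q′)`. -/
lemma transfer_Q (p : E → R) {ends : E → Sym2 V} {g : E} {a₁ v : V} (hg : ends g = s(a₁, v))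
    (a₂ : V) :
    prob (Function.update p g 1) (avoidAll ends a₂ {a₁}) =
      prob (Function.update p g 0) {ω' | ω' ∈ avoidAll ends a₂ {a₁} ∧ ¬ Conn ends ω' a₂ v} := by
  refine prob_update_one_eq_prob_update_zero p g fun ω => ?_
  rw [← Function.update_idem false true ω, mem_Q_update_true_iff hg, Set.mem_setOf_eq]

omit [DecidableEq V] [LinearOrder R] [IsStrictOrderedRing R] in
/-- `P¹(Q, o ∈ C₂) = P⁰(Q′, o ∈ C₂)`. -/
lemma transfer_oH (p : E → R) {ends : E → Sym2 V} {g : E} {a₁ v : V} (hg : ends g = s(a₁, v))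
    (a₂ o : V) :
    prob (Function.update p g 1) (avoidAll ends a₂ {a₁} ∩ connEvent ends a₂ o) =
      prob (Function.update p g 0) {ω' | ω' ∈ avoidAll ends a₂ {a₁} ∧ ¬ Conn ends ω' a₂ v ∧
        Conn ends ω' a₂ o} := by
  refine prob_update_one_eq_prob_update_zero p g fun ω => ?_
  rw [← Function.update_idem false true ω, mem_Q_inter_connH_update_true_iff hg,
    Set.mem_setOf_eq]

omit [DecidableEq V] [LinearOrder R] [IsStrictOrderedRing R] in
/-- `P¹(Q, b ∈ C₁) = P⁰(Q′, b ∈ C₁ ∪ C(v))`. -/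
lemma transfer_bL (p : E → R) {ends : E → Sym2 V} {g : E} {a₁ v : V} (hg : ends g = s(a₁, v))
    (a₂ b : V) :
    prob (Function.update p g 1) (avoidAll ends a₂ {a₁} ∩ connEvent ends a₁ b) =
      prob (Function.update p g 0) {ω' | ω' ∈ avoidAll ends a₂ {a₁} ∧ ¬ Conn ends ω' a₂ v ∧
        (Conn ends ω' a₁ b ∨ Conn ends ω' v b)} := by
  refine prob_update_one_eq_prob_update_zero p g fun ω => ?_
  rw [← Function.update_idem false true ω, mem_Q_inter_connL_update_true_iff hg,
    Set.mem_setOf_eq]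

omit [DecidableEq V] [LinearOrder R] [IsStrictOrderedRing R] in
/-- `P¹(Q, o ∈ C₂, b ∈ C₁) = P⁰(Q′, o ∈ C₂, b ∈ C₁ ∪ C(v))`. -/
lemma transfer_oHbL (p : E → R) {ends : E → Sym2 V} {g : E} {a₁ v : V} (hg : ends g = s(a₁, v))
    (a₂ b o : V) :
    prob (Function.update p g 1)
        (avoidAll ends a₂ {a₁} ∩ (connEvent ends a₂ o ∩ connEvent ends a₁ b)) =
      prob (Function.update p g 0) {ω' | ω' ∈ avoidAll ends a₂ {a₁} ∧ ¬ Conn ends ω' a₂ v ∧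
        Conn ends ω' a₂ o ∧ (Conn ends ω' a₁ b ∨ Conn ends ω' v b)} := by
  refine prob_update_one_eq_prob_update_zero p g fun ω => ?_
  rw [← Function.update_idem false true ω, mem_Q_inter_connH_connL_update_true_iff hg,
    Set.mem_setOf_eq]


/-! ## The half identity: `Ψ₀₁ + Ψ₁₀ − Ψ₁₁ = Ψ′ + cross_h + cross_F` for the pair `(b ∈ C₁, o ∈ C₂)` -/

omit [DecidableEq V] [LinearOrder R] [IsStrictOrderedRing R] in
/-- **The root-edge half identity.**  With `P^s = p[g := s]`, `g = {a₁, v}`, and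
`Ψ_st = P^s(Q, bL) P^t(Q, oH) − P^s(Q, oH, bL) P^t(Q)` (the `(b ∈ C₁, o ∈ C₂)`-half of the BHK slack
between two laws), the mixed half-slack `Ψ₀₁ + Ψ₁₀ − Ψ₁₁` equals `Ψ′` (the same half-slack of `P⁰`
on `Q′ = Q ∩ {v ∉ C₂}`) plus the (3M)-term `m(101)m(010) + m(001)m(110) − m(011)m(100) − m(111)m(000)`
in the cells of `P⁰` plus the (F)-term `P⁰(Q,vH,oH)·P⁰(Q,b~v) − P⁰(Q,vH)·P⁰(Q,oH,b~v)`. -/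
theorem half_identity (p : E → R) {ends : E → Sym2 V} {g : E} {a₁ v : V} (hg : ends g = s(a₁, v))
    (a₂ b o : V) :
    (prob (Function.update p g 0) (avoidAll ends a₂ {a₁} ∩ connEvent ends a₁ b) *
          prob (Function.update p g 1) (avoidAll ends a₂ {a₁} ∩ connEvent ends a₂ o) -
        prob (Function.update p g 0)
            (avoidAll ends a₂ {a₁} ∩ (connEvent ends a₂ o ∩ connEvent ends a₁ b)) *
          prob (Function.update p g 1) (avoidAll ends a₂ {a₁})) +
      (prob (Function.update p g 1) (avoidAll ends a₂ {a₁} ∩ connEvent ends a₁ b) *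
          prob (Function.update p g 0) (avoidAll ends a₂ {a₁} ∩ connEvent ends a₂ o) -
        prob (Function.update p g 1)
            (avoidAll ends a₂ {a₁} ∩ (connEvent ends a₂ o ∩ connEvent ends a₁ b)) *
          prob (Function.update p g 0) (avoidAll ends a₂ {a₁})) -
      (prob (Function.update p g 1) (avoidAll ends a₂ {a₁} ∩ connEvent ends a₁ b) *
          prob (Function.update p g 1) (avoidAll ends a₂ {a₁} ∩ connEvent ends a₂ o) -
        prob (Function.update p g 1)
            (avoidAll ends a₂ {a₁} ∩ (connEvent ends a₂ o ∩ connEvent ends a₁ b)) *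
          prob (Function.update p g 1) (avoidAll ends a₂ {a₁})) =
      (prob (Function.update p g 0)
            {ω' | ω' ∈ avoidAll ends a₂ {a₁} ∧ ¬ Conn ends ω' a₂ v ∧ Conn ends ω' a₁ b} *
          prob (Function.update p g 0)
            {ω' | ω' ∈ avoidAll ends a₂ {a₁} ∧ ¬ Conn ends ω' a₂ v ∧ Conn ends ω' a₂ o} -
        prob (Function.update p g 0)
            {ω' | ω' ∈ avoidAll ends a₂ {a₁} ∧ ¬ Conn ends ω' a₂ v ∧ Conn ends ω' a₂ o ∧
              Conn ends ω' a₁ b} *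
          prob (Function.update p g 0)
            {ω' | ω' ∈ avoidAll ends a₂ {a₁} ∧ ¬ Conn ends ω' a₂ v}) +
      (cell (Function.update p g 0) ends a₁ a₂ b o v true false true *
            cell (Function.update p g 0) ends a₁ a₂ b o v false true false +
          cell (Function.update p g 0) ends a₁ a₂ b o v false false true *
            cell (Function.update p g 0) ends a₁ a₂ b o v true true false -
          cell (Function.update p g 0) ends a₁ a₂ b o v false true true *
            cell (Function.update p g 0) ends a₁ a₂ b o v true false false -
          cell (Function.update p g 0) ends a₁ a₂ b o v true true true *
            cell (Function.update p g 0) ends a₁ a₂ b o v false false false) +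
      ((cell (Function.update p g 0) ends a₁ a₂ b o v true true true +
            cell (Function.update p g 0) ends a₁ a₂ b o v true true false) *
          (bvcell (Function.update p g 0) ends a₁ a₂ b o v true +
            bvcell (Function.update p g 0) ends a₁ a₂ b o v false) -
        (cell (Function.update p g 0) ends a₁ a₂ b o v true true true +
            cell (Function.update p g 0) ends a₁ a₂ b o v true true false +
            cell (Function.update p g 0) ends a₁ a₂ b o v true false true +
            cell (Function.update p g 0) ends a₁ a₂ b o v true false false) *
          bvcell (Function.update p g 0) ends a₁ a₂ b o v true) := by
  rw [transfer_Q p hg, transfer_oH p hg, transfer_bL p hg, transfer_oHbL p hg,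
    mass_Q, mass_bL, mass_oH, mass_oHbL, mass_Q', mass_Q'oH, mass_Q'bL, mass_Q'oHbL,
    mass_Q'bLv, mass_Q'oHbLv]
  ring

/-! ## The corrected candidate: the per-pair cross term `RootCross` -/

/-- **`RootCross`, a CANDIDATE (NOT claimed proved)**: the `(b ∈ C₁, o ∈ C₂)`-cross term of the
root-edge row, `cross_h + cross_F ≥ 0`, i.e. with `m⁺(0, ω, 1) = m(0, ω, 1) + bvcell ω` and
`m⁺(0, ω, 0) = m(0, ω, 0) − bvcell ω` (`b`'s side measured against `C₁ ∪ C(v)` in the world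
`{v ∉ C₂}`): `m⁺(011)m(100) + m(111)m⁺(000) ≤ m(101)m⁺(010) + m⁺(001)m(110)`.  It is the mixed
BHK06 Thm 1.4 cross term between the world `{v ∈ C₂}` of `G − g` and the contraction `G / g`.
Census (night-3 g21, exact): 0 failures on every per-pair row examined (kit j308130's 227
(F)-failures, the local census, kit j308669); the two summands separately are NOT both candidates
(`BVCross` is false, `ThreeMark` stands). -/
def RootCross (ends : E → Sym2 V) (a₁ a₂ b o v : V) : Prop :=
  ∀ (p : E → R), IsProbVec p →
    (cell p ends a₁ a₂ b o v false true true + bvcell p ends a₁ a₂ b o v true) *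
          cell p ends a₁ a₂ b o v true false false +
        cell p ends a₁ a₂ b o v true true true *
          (cell p ends a₁ a₂ b o v false false false - bvcell p ends a₁ a₂ b o v false) ≤
      cell p ends a₁ a₂ b o v true false true *
          (cell p ends a₁ a₂ b o v false true false - bvcell p ends a₁ a₂ b o v true) +
        (cell p ends a₁ a₂ b o v false false true + bvcell p ends a₁ a₂ b o v false) *
          cell p ends a₁ a₂ b o v true true false

end RootEdge

end CovForm

end Summit.Ventures.PercRepro2
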